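import Literature.NumberTheory.DiophantineGeometry.KroneckerPointSets
import HarnessLib

/-!
# Ikenmeyer–Panova 2017, Cor. 4.4: hooks have positive rectangular Kronecker coefficients —
# proved from the one-row positivity, the semigroup property and the transposition property;
# square positivity for squares of square side

Sibling proofs file (D-0014) of `Literature/Computability/Complexity/OccurrenceObstructionsIP.lean`
(conventions as there: `Nat.Partition.rectangle a b` = `a × b` = `a` rows of length `b`,
row-wise sum `Nat.Partition.rowAdd`, everything over `ℂ`). Theorems only; no statement of the
tree is changed and no named fact is introduced.

Source: C. Ikenmeyer, G. Panova, *Rectangular Kronecker coefficients and plethysms in geometric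
complexity theory*, Adv. Math. 319 (2017) 40–66 = arXiv:1512.03798 (held), §4: Prop. 4.3
(held: Prop. 20) and its proof (the claim "`k ∈ P_c` implies `k, k + 2c + 1 ∈ P_{c+1}`"),
Cor. 4.4 (held: Cor. 21): "Let `w ≥ h ≥ 7`, then `g((hw - j, 1^j), h × w, h × w) > 0` for all
`j ∈ [0, h² - 1] ∖ {1, 2, 4, 6, h² - 2, h² - 3, h² - 5, h² - 7}`", whose printed proof applies
Prop. 4.3 with `ρ = ∅`, `a = 7`, `H¹_ρ = {1, 2, 4, 6}`, `H²_ρ = {2, 3, 5, 7}` and states "The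
values at `a = 7` are readily verified by direct computation" (Kronecker coefficients of `S₄₉`).

## What is proved

1. **IP Cor. 4.4, unconditionally** (`ikenmeyerPanova2017_cor_4_4`, square frame
   `ikenmeyerPanova2017_cor_4_4_square`, and in the `body` vocabulary of the statement file
   `ikenmeyerPanova2017_cor_4_4_body`). The three tools are tree theorems: the semigroup property
   (`ikenmeyerPanova2017_semigroup_holds`), the transposition property
   (`kroneckerCoeff_transpose₁₂`, `kroneckerCoeff_rectangle_transpose`) and `g((n), μ, μ) = 1`
   (`kroneckerCoeff_indiscrete_pos`). The induction of Prop. 4.3 (for `ρ = ∅`) is `hookSquare_pos`;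
   its two moves are `hookSquare_pos_grow` (add the one-row triples `((c), c × 1, c × 1)`,
   `((c+1), (c+1) × 1, (c+1) × 1)`, transposing the rectangles in between:
   `kroneckerCoeff_pos_rowAdd_row_holds`, `kroneckerCoeff_pos_rowAdd_row_rows`) and
   `hookSquare_pos_grow_add` (conjugate the hook against the square,
   `kroneckerCoeff_square_frame_transpose`: `(c² - k, 1^k)ᵀ = (k + 1, 1^{c² - 1 - k})`).
2. **The computed base case `a = 7` is DERIVED, not computed** (`hookSquare_pos_seven`): writing
   `P_c` for the set of legs `k` with `g((c² - k, 1^k), c × c, c × c) > 0`, the two moves give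
   `P_{c+1} ⊇ P_c ∪ (P_c + 2c + 1)` for every `c ≥ 1`, and `P_1 ∋ 0` (`g((1), (1), (1)) = 1`); hence
   `P_c` contains every sum of distinct elements of `{3, 5, …, 2c - 1}` (`hookSquare_pos_sum_odd`),
   which for `c = 7` is exactly `[0, 48] ∖ {1, 2, 4, 6, 42, 44, 46, 47}`
   (`exists_sum_odd_eq_of_lt_49`, a `decide`) — IP's table. So Cor. 4.4 rests on no computation.
3. **Square positivity for squares of square side** (`ikenmeyerPanova2017_square_pos_of_sq`:
   `g(k × k, k × k, k × k) > 0` for `k = s²`), the case `k = s²` of the Bessenrodt–Behns square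
   positivity quoted in IP §1.1 (the named fact `ikenmeyerPanova2017_square_pos` of the statement
   file), from the same three tools: `t` copies of `(s × s, s × s, (1^{s²}))`
   (`kroneckerCoeff_indiscrete_transpose_pos`: the square is self-conjugate) give
   `(s × st, s × st, (s²) × t)` (`kroneckerCoeff_rect_rect_tallRect_pos`); at `t = s`, transposing
   the two wide rectangles gives the cube of the tall rectangle `(s²) × s`
   (`kroneckerCoeff_tallRect_cube_pos`), and `u` of these side by side the cube of `(s²) × (su)`
   (`kroneckerCoeff_rectangle_sq_mul_cube_pos`).

4. **Summand (IV) of the proof of Thm. 4.6, in every frame**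
   (`ikenmeyerPanova2017_thm_4_6_summand_IV`, `…_IV'`, from `exists_colUnion_pos` and the
   two-directional frame growth `kroneckerCoeff_pos_of_frame_le`/`…'`): if the body of `λ ⊢ ab`
   is a union of columns (multiplicities allowed) whose lengths are legs admitted by Cor. 4.4 for
   some `h ≥ 7`, then `g(λ, a × b, a × b) > 0` as soon as `a ≥ h` and `b ≥ h·#columns` (or
   `a ≥ h·#columns` and `b ≥ h`) — Cor. 4.4 plus the semigroup property; unconditional.

## What is NOT here: IP Thm. 4.6 (`ikenmeyerPanova2017_thm_4_6`) and Cor. 4.5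

The discharge of the main positivity theorem (held: Thm. 23) is out of reach of the present tree
for two independent reasons, recorded here for the next attempt.
* Its proof packs the bulk of `ν` into blocks `(k-1) × (ks)` through Lemma 4.2
  (`ikenmeyerPanova2017_lemma_4_2_of_square_pos`), which needs `g(k × k, k × k, k × k) > 0` for
  every `k ≤ ℓ(ν) + 1` (Bessenrodt–Behns; characters of the alternating groups). For `k` not a
  perfect square this is a genuine new input: `(2 × 2)³` and `(3 × 3)³` admit no nontrivial
  row-wise decomposition into positive triples (a row-wise summand of a `k × k` rectangle is a
  `k × kᵢ` rectangle, and `g((1,1), (1,1), (1,1)) = g((1³), (1³), (1³)) = 0`), and they are fixed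
  by the transpositions; item 3 above is as far as the three tools reach.
* Its remaining base cases — Cor. 4.5 (held: Cor. 22, hooks plus `ρ`, `|ρ| ≤ 6`, "verified
  computationally" at `h = w = 7`) and "a finite calculation shows `g(ρ(49), 7 × 7, 7 × 7) > 0`"
  in the proof of Thm. 4.6 — are NOT consequences of the three tools even granted all square
  cubes: e.g. the two-row shape `(N - 3, 3)` against any rectangle frame `R` (body `ρ = (3)`,
  case (5) of Lemma 4.1) is not a row-wise sum of two positive triples of the form
  `(λ, R', R')` (one summand would have body `(1)`, and `g((n-1, 1), R', R') = 0` for rectangles),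
  nor is any member of its transposition orbit, nor is it a seed; an exhaustive search of the
  closure of {one-row triples} ∪ {all square cubes} in frames up to `9 × 9` likewise misses the
  bodies `(3), (5), (7), (2,2), (2⁴), (3,2), (4,1), (2,1,1,1), (3,1,1,1), …` required there. (Their
  positivity is true — `g((ab - m, m), a × b, a × b) = p_{a,b}(m) - p_{a,b}(m-1) ≥ 1` for `m ≥ 2`
  by Young's rule and the Littlewood–Richardson rule for rectangles — but that theory is not in
  the tree.)

## References

* C. Ikenmeyer, G. Panova, Adv. Math. 319 (2017) 40–66 = arXiv:1512.03798, §1.1 (the three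
  properties), §4: Lemma 4.2, Prop. 4.3 (proof of the claim), Cor. 4.4, Cor. 4.5, Thm. 4.6 (held
  text: Lemma 19, Prop. 20, Cor. 21, Cor. 22, Thm. 23, pp. 9–12). [key `IkenmeyerPanova2017`]
* C. Bessenrodt, C. Behns, J. Algebra 280 (2004) 132–144 (the square positivity, as quoted in
  IP §1.1).

## Mathlib and tree

Mathlib: `Nat.Partition` (`ofSums`, `indiscrete`, `partition_zero_parts`), `YoungDiagram`
(`mem_iff_lt_rowLen`, `mem_iff_lt_colLen`), `Multiset.sort_cons`, `Finset.sum_erase_add`,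
`Nat.le_induction`, `Multiset.induction_on`, `Finset.sum_range_succ'`, `decide`. Tree: `kroneckerCoeff`, `kroneckerCoeff_transpose₁₂`,
`kroneckerCoeff_comm₁₂_holds`/`comm₂₃_holds`, `kroneckerCoeff_indiscrete_pos`,
`kroneckerCoeff_indiscrete_transpose_pos`, `getD_sortedParts_transpose`,
`getD_sortedParts_indiscrete_transpose`, `sortedParts_indiscrete`, `rowLen_youngDiagram`
(`Literature.NumberTheory.DiophantineGeometry`); `Nat.Partition.rowAdd`, `getD_sortedParts_rowAdd`,
`body`, `sup_mem_of_ne_zero`, `parts_eq_of_youngDiagram_eq`, `transpose_rectangle_parts`,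
`sortedParts_rectangle`, `rowAdd_rectangle_parts`, `kroneckerCoeff_congr_parts`,
`kroneckerCoeff_pos_of_eq_zero`, `kroneckerCoeff_rectangle_transpose`,
`kroneckerCoeff_pos_rowAdd_row_holds`, `ikenmeyerPanova2017_semigroup_holds`
(`Literature.Computability.Complexity`). No new definitions.
-/

noncomputable section

open scoped BigOperators

namespace Literature.Computability.Complexity

open Literature.NumberTheory.DiophantineGeometry (kroneckerCoeff kroneckerCoeff_transpose₁₂
  kroneckerCoeff_indiscrete_pos kroneckerCoeff_indiscrete_transpose_pos getD_sortedParts_transpose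
  rowLen_youngDiagram sortedParts_indiscrete)

/-! ### Partitions through their rows -/

section Rows

variable {N N' : ℕ}

/-- The sorted parts depend only on the multiset of parts (any written sizes). [folklore] -/
theorem sortedParts_congr_parts {μ : Nat.Partition N} {ν : Nat.Partition N'}
    (h : μ.parts = ν.parts) : μ.sortedParts = ν.sortedParts := by
  unfold Nat.Partition.sortedParts
  rw [h]

/-- Two partitions (of possibly differently written sizes) with the same zero-padded rows have the
same parts. [folklore] -/
theorem parts_eq_of_getD_sortedParts_eq {μ : Nat.Partition N} {ν : Nat.Partition N'}
    (h : ∀ r, μ.sortedParts.getD r 0 = ν.sortedParts.getD r 0) : μ.parts = ν.parts := by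
  refine parts_eq_of_youngDiagram_eq (SetLike.ext fun c => ?_)
  obtain ⟨i, j⟩ := c
  rw [YoungDiagram.mem_iff_lt_rowLen, YoungDiagram.mem_iff_lt_rowLen, rowLen_youngDiagram,
    rowLen_youngDiagram, h]

/-- Boxes below row `i` in column `j`: `i < λᵀ_j ↔ j < λ_i` (zero-padded rows). [folklore] -/
theorem lt_colLen_iff (μ : Nat.Partition N) (i j : ℕ) :
    i < μ.youngDiagram.colLen j ↔ j < μ.sortedParts.getD i 0 := by
  rw [← YoungDiagram.mem_iff_lt_colLen, YoungDiagram.mem_iff_lt_rowLen, rowLen_youngDiagram]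

/-- The length of column `j` is `k` as soon as exactly the rows `i < k` reach column `j`.
[folklore] -/
theorem colLen_eq_of_forall (μ : Nat.Partition N) {j k : ℕ}
    (h : ∀ i, j < μ.sortedParts.getD i 0 ↔ i < k) : μ.youngDiagram.colLen j = k := by
  have h' : ∀ i, i < μ.youngDiagram.colLen j ↔ i < k := fun i => (lt_colLen_iff μ i j).trans (h i)
  refine le_antisymm (not_lt.1 fun hlt => ?_) (not_lt.1 fun hlt => ?_)
  · exact lt_irrefl _ ((h' k).1 hlt)
  · exact lt_irrefl _ ((h' _).2 hlt)

/-- The rows of a row-wise sum do not depend on the written sizes. [folklore] -/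
theorem rowAdd_parts_congr {a b a' b' : ℕ} {lam : Nat.Partition a} {lam' : Nat.Partition a'}
    {mu : Nat.Partition b} {mu' : Nat.Partition b'} (hl : lam.parts = lam'.parts)
    (hm : mu.parts = mu'.parts) : (lam.rowAdd mu).parts = (lam'.rowAdd mu').parts :=
  parts_eq_of_getD_sortedParts_eq fun r => by
    rw [getD_sortedParts_rowAdd, getD_sortedParts_rowAdd, sortedParts_congr_parts hl,
      sortedParts_congr_parts hm]

/-- The one-row partition `(M)` has the single row `M` (none if `M = 0`). [folklore] -/
theorem getD_sortedParts_indiscrete (M r : ℕ) :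
    (Nat.Partition.indiscrete M).sortedParts.getD r 0 = if r = 0 then M else 0 := by
  rcases Nat.eq_zero_or_pos M with rfl | hM
  · have h0 : (Nat.Partition.indiscrete 0).sortedParts = [] := by
      rw [← List.length_eq_zero_iff, Nat.Partition.length_sortedParts,
        Nat.Partition.partition_zero_parts, Multiset.card_zero]
    simp [h0]
  · rw [sortedParts_indiscrete hM.ne']
    cases r <;> simp

/-- **Adding `M` boxes to the first row**: the rows of `λ + (M)`. [folklore] -/
theorem getD_sortedParts_rowAdd_indiscrete {a : ℕ} (lam : Nat.Partition a) (M r : ℕ) :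
    (lam.rowAdd (Nat.Partition.indiscrete M)).sortedParts.getD r 0 =
      lam.sortedParts.getD r 0 + if r = 0 then M else 0 := by
  rw [getD_sortedParts_rowAdd, getD_sortedParts_indiscrete]

end Rows

/-! ### Hooks `(N - k, 1^k)` described by their parts -/

section Hooks

variable {N : ℕ}

/-- Sorting a constant multiset of ones. [folklore] -/
theorem sort_replicate_one (n : ℕ) :
    (Multiset.replicate n 1).sort (· ≥ ·) = List.replicate n 1 := by
  induction n with
  | zero => simp
  | succ n ih =>
    rw [Multiset.replicate_succ, Multiset.sort_cons, ih, List.replicate_succ]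
    intro b hb
    rw [Multiset.eq_of_mem_replicate hb]

/-- **The hook `(N - k, 1^k) ⊢ N` exists** for `k < N` (as a partition with parts
`{N - k, 1, …, 1}`). [cite: IkenmeyerPanova2017, §4 (the hook partitions (i, 1^j), before Cor. 4.4; held p. 11)] -/
theorem exists_parts_eq_hook {k : ℕ} (hk : k < N) :
    ∃ lam : Nat.Partition N, lam.parts = (N - k) ::ₘ Multiset.replicate k 1 := by
  refine ⟨⟨(N - k) ::ₘ Multiset.replicate k 1, fun {x} hx => ?_, ?_⟩, rfl⟩
  · rcases Multiset.mem_cons.1 hx with rfl | hx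
    · omega
    · rw [Multiset.eq_of_mem_replicate hx]; exact Nat.one_pos
  · rw [Multiset.sum_cons, Multiset.sum_replicate, smul_eq_mul, mul_one]
    omega

/-- The rows of the hook `(N - k, 1^k)`: `N - k`, then `k` rows of length `1`. [folklore] -/
theorem getD_sortedParts_of_parts_eq_hook {M : ℕ} {lam : Nat.Partition M} {k : ℕ} (hk : k < N)
    (hlam : lam.parts = (N - k) ::ₘ Multiset.replicate k 1) (r : ℕ) :
    lam.sortedParts.getD r 0 = if r = 0 then N - k else if r ≤ k then 1 else 0 := by
  have hs : lam.sortedParts = (N - k) :: List.replicate k 1 := by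
    unfold Nat.Partition.sortedParts
    rw [hlam, Multiset.sort_cons, sort_replicate_one]
    intro b hb
    rw [Multiset.eq_of_mem_replicate hb]
    show 1 ≤ N - k
    omega
  rw [hs]
  cases r with
  | zero => simp
  | succ r =>
    rw [List.getD_cons_succ, List.getD_eq_getElem?_getD, List.getElem?_replicate,
      if_neg (Nat.succ_ne_zero r)]
    by_cases hr : r < k
    · rw [if_pos hr, if_pos (by omega)]; rfl
    · rw [if_neg hr, if_neg (by omega)]; rfl

/-- **The transpose of a hook is a hook**: `(N - k, 1^k)ᵀ = (k + 1, 1^{N-k-1})`, i.e. the hook with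
leg `N - 1 - k` (by its parts). [folklore] -/
theorem parts_transpose_of_parts_eq_hook {lam : Nat.Partition N} {k : ℕ} (hk : k < N)
    (hlam : lam.parts = (N - k) ::ₘ Multiset.replicate k 1) :
    lam.transpose.parts = (N - (N - 1 - k)) ::ₘ Multiset.replicate (N - 1 - k) 1 := by
  obtain ⟨nu, hnu⟩ := exists_parts_eq_hook (N := N) (k := N - 1 - k) (by omega)
  rw [← hnu]
  refine parts_eq_of_getD_sortedParts_eq fun i => ?_
  rw [getD_sortedParts_transpose, getD_sortedParts_of_parts_eq_hook (by omega) hnu]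
  refine colLen_eq_of_forall lam fun r => ?_
  rw [getD_sortedParts_of_parts_eq_hook hk hlam]
  split_ifs <;> omega

/-- **Adding `M` boxes to the first row of a hook gives the hook with the same leg**:
`(N - k, 1^k) + (M) = (N + M - k, 1^k)` (by its parts). [folklore] -/
theorem parts_rowAdd_indiscrete_of_parts_eq_hook {lam : Nat.Partition N} {k : ℕ} (hk : k < N)
    (hlam : lam.parts = (N - k) ::ₘ Multiset.replicate k 1) (M : ℕ) :
    (lam.rowAdd (Nat.Partition.indiscrete M)).parts =
      (N + M - k) ::ₘ Multiset.replicate k 1 := by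
  obtain ⟨nu, hnu⟩ := exists_parts_eq_hook (N := N + M) (k := k) (by omega)
  rw [← hnu]
  refine parts_eq_of_getD_sortedParts_eq fun r => ?_
  rw [getD_sortedParts_rowAdd_indiscrete, getD_sortedParts_of_parts_eq_hook hk hlam,
    getD_sortedParts_of_parts_eq_hook (by omega) hnu]
  split_ifs <;> omega

end Hooks

/-! ### The moves: growing the frame and transposing the shape -/

section Moves

/-- **Growing the number of rows of the frame**: if `g(λ, c × d, c × d) > 0` then
`g(λ + (Md), (c + M) × d, (c + M) × d) > 0` (IP, proof of Prop. 4.3: add the one-row triple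
and transpose the rectangles, twice). [cite: IkenmeyerPanova2017, Prop. 4.3 (proof of the claim; held: Prop. 20, p. 10)] -/
theorem kroneckerCoeff_pos_rowAdd_row_rows {c d M : ℕ} (lam : Nat.Partition (c * d))
    (h : 0 < kroneckerCoeff ℂ lam (Nat.Partition.rectangle c d) (Nat.Partition.rectangle c d))
    (mu : Nat.Partition ((c + M) * d))
    (hmu : mu.parts = (lam.rowAdd (Nat.Partition.indiscrete (M * d))).parts) :
    0 < kroneckerCoeff ℂ mu (Nat.Partition.rectangle (c + M) d)
      (Nat.Partition.rectangle (c + M) d) := by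
  let lam' : Nat.Partition (d * c) := ⟨lam.parts, lam.parts_pos, by rw [lam.parts_sum, mul_comm]⟩
  have h' : 0 < kroneckerCoeff ℂ lam' (Nat.Partition.rectangle d c)
      (Nat.Partition.rectangle d c) := by
    rwa [kroneckerCoeff_rectangle_transpose lam lam' rfl] at h
  let mu' : Nat.Partition (d * (c + M)) :=
    ⟨mu.parts, mu.parts_pos, by rw [mu.parts_sum, mul_comm]⟩
  have hmu' : mu'.parts = (lam'.rowAdd (Nat.Partition.indiscrete (d * M))).parts := by
    change mu.parts = _
    rw [hmu]
    exact rowAdd_parts_congr rfl (by rw [Nat.mul_comm M d])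
  have h2 := kroneckerCoeff_pos_rowAdd_row_holds lam' h' mu' hmu'
  rwa [← kroneckerCoeff_rectangle_transpose mu mu' rfl] at h2

/-- **Transposing the shape against a square frame**: `g(λ, c × c, c × c) = g(λᵀ, c × c, c × c)`
(IP, proof of Prop. 4.3: "we first transpose `ν^k(c²)` and one of the squares"), from the
transposition property `g(λ, μ, ν) = g(λᵀ, μᵀ, ν)` and `(c × c)ᵀ = c × c`.
[cite: IkenmeyerPanova2017, Prop. 4.3 (proof of the claim; held: Prop. 20, p. 10)] -/
theorem kroneckerCoeff_square_frame_transpose {c : ℕ} (lam : Nat.Partition (c * c)) :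
    kroneckerCoeff ℂ lam (Nat.Partition.rectangle c c) (Nat.Partition.rectangle c c) =
      kroneckerCoeff ℂ lam.transpose (Nat.Partition.rectangle c c)
        (Nat.Partition.rectangle c c) := by
  rw [kroneckerCoeff_transpose₁₂ ℂ lam]
  exact kroneckerCoeff_congr_parts rfl (lam' := lam.transpose)
    (mu' := Nat.Partition.rectangle c c) (nu' := Nat.Partition.rectangle c c) rfl
    (transpose_rectangle_parts c c) rfl

end Moves


/-! ### Bootstrapping the hooks against squares from `g((1), (1), (1)) = 1` -/

section Bootstrap

/-- **The seed**: `g((1), 1 × 1, 1 × 1) = 1 > 0` — the hook with leg `0` against the `1 × 1`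
square. [folklore] -/
theorem hookSquare_pos_one (lam : Nat.Partition (1 * 1))
    (_hlam : lam.parts = (1 * 1 - 0) ::ₘ Multiset.replicate 0 1) :
    0 < kroneckerCoeff ℂ lam (Nat.Partition.rectangle 1 1) (Nat.Partition.rectangle 1 1) := by
  have h : lam = Nat.Partition.indiscrete (1 * 1) := Nat.Partition.ext (by simp)
  rw [h]
  exact kroneckerCoeff_indiscrete_pos ℂ _

/-- **Growing the square** (IP, proof of Prop. 4.3, first half of the claim: "`k ∈ P_c` implies
`k ∈ P_{c+1}`"): if `g((c² - k, 1^k), c × c, c × c) > 0` then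
`g(((c+1)² - k, 1^k), (c+1) × (c+1), (c+1) × (c+1)) > 0` — add the one-row triples
`((c), c × 1, c × 1)` and `((c+1), (c+1) × 1, (c+1) × 1)`, transposing the rectangles in between.
[cite: IkenmeyerPanova2017, Prop. 4.3 (proof of the claim; held: Prop. 20, p. 10)] -/
theorem hookSquare_pos_grow {c k : ℕ} (hk : k < c * c)
    (h : ∀ lam : Nat.Partition (c * c), lam.parts = (c * c - k) ::ₘ Multiset.replicate k 1 →
      0 < kroneckerCoeff ℂ lam (Nat.Partition.rectangle c c) (Nat.Partition.rectangle c c))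
    (lam : Nat.Partition ((c + 1) * (c + 1)))
    (hlam : lam.parts = ((c + 1) * (c + 1) - k) ::ₘ Multiset.replicate k 1) :
    0 < kroneckerCoeff ℂ lam (Nat.Partition.rectangle (c + 1) (c + 1))
      (Nat.Partition.rectangle (c + 1) (c + 1)) := by
  obtain ⟨lam₀, hlam₀⟩ := exists_parts_eq_hook (N := c * c) hk
  have h₀ := h lam₀ hlam₀
  -- grow the columns: frame `c × (c + 1)`
  have e₁ : c * (c + 1) = c * c + c * 1 := by ring
  obtain ⟨mu, hmu⟩ := exists_parts_eq_hook (N := c * (c + 1)) (k := k) (by nlinarith)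
  have hmu' : mu.parts = (lam₀.rowAdd (Nat.Partition.indiscrete (c * 1))).parts := by
    rw [hmu, parts_rowAdd_indiscrete_of_parts_eq_hook hk hlam₀ (c * 1), e₁]
  have h₁ := kroneckerCoeff_pos_rowAdd_row_holds lam₀ h₀ mu hmu'
  -- grow the rows: frame `(c + 1) × (c + 1)`
  have e₂ : (c + 1) * (c + 1) = c * (c + 1) + 1 * (c + 1) := by ring
  have hlam' : lam.parts = (mu.rowAdd (Nat.Partition.indiscrete (1 * (c + 1)))).parts := by
    rw [hlam, parts_rowAdd_indiscrete_of_parts_eq_hook (by nlinarith) hmu (1 * (c + 1)), e₂]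
  exact kroneckerCoeff_pos_rowAdd_row_rows mu h₁ lam hlam'

/-- **Transposing the hook** (IP, proof of Prop. 4.3, second half of the claim): against a square
frame, `g((c² - k, 1^k), c², c²) = g((k + 1, 1^{c² - 1 - k}), c², c²)`, so leg `k` is positive iff
leg `c² - 1 - k` is. [cite: IkenmeyerPanova2017, Prop. 4.3 (proof of the claim; held: Prop. 20, p. 10)] -/
theorem hookSquare_pos_transpose {c k : ℕ} (hk : k < c * c)
    (h : ∀ lam : Nat.Partition (c * c), lam.parts = (c * c - k) ::ₘ Multiset.replicate k 1 →
      0 < kroneckerCoeff ℂ lam (Nat.Partition.rectangle c c) (Nat.Partition.rectangle c c))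
    (lam : Nat.Partition (c * c))
    (hlam : lam.parts = (c * c - (c * c - 1 - k)) ::ₘ Multiset.replicate (c * c - 1 - k) 1) :
    0 < kroneckerCoeff ℂ lam (Nat.Partition.rectangle c c) (Nat.Partition.rectangle c c) := by
  obtain ⟨lam₀, hlam₀⟩ := exists_parts_eq_hook (N := c * c) hk
  have h₀ := h lam₀ hlam₀
  rw [kroneckerCoeff_square_frame_transpose] at h₀
  have he : lam = lam₀.transpose :=
    Nat.Partition.ext (hlam.trans (parts_transpose_of_parts_eq_hook hk hlam₀).symm)
  rwa [he]

/-- **The claim in the proof of IP Prop. 4.3** (held: Prop. 20): "`k ∈ P_c` implies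
`k + 2c + 1 ∈ P_{c+1}`" for hooks — transpose, grow, transpose.
[cite: IkenmeyerPanova2017, Prop. 4.3 (proof of the claim; held: Prop. 20, p. 10)] -/
theorem hookSquare_pos_grow_add {c k : ℕ} (hk : k < c * c)
    (h : ∀ lam : Nat.Partition (c * c), lam.parts = (c * c - k) ::ₘ Multiset.replicate k 1 →
      0 < kroneckerCoeff ℂ lam (Nat.Partition.rectangle c c) (Nat.Partition.rectangle c c))
    (lam : Nat.Partition ((c + 1) * (c + 1)))
    (hlam : lam.parts = ((c + 1) * (c + 1) - (k + 2 * c + 1)) ::ₘ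
      Multiset.replicate (k + 2 * c + 1) 1) :
    0 < kroneckerCoeff ℂ lam (Nat.Partition.rectangle (c + 1) (c + 1))
      (Nat.Partition.rectangle (c + 1) (c + 1)) := by
  have h₁ := hookSquare_pos_transpose hk h
  have h₂ := hookSquare_pos_grow (c := c) (k := c * c - 1 - k) (by omega) h₁
  have hsq : (c + 1) * (c + 1) = c * c + 2 * c + 1 := by ring
  have h₃ := hookSquare_pos_transpose (c := c + 1) (k := c * c - 1 - k) (by omega) h₂
  have e : (c + 1) * (c + 1) - 1 - (c * c - 1 - k) = k + 2 * c + 1 := by omega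
  rw [e] at h₃
  exact h₃ lam hlam

/-- **All sums of distinct odd numbers `3, 5, …, 2c - 1` are positive legs against `c × c`**:
for `S ⊆ [1, c)`, `k = ∑_{i ∈ S} (2i + 1) < c²` and `g((c² - k, 1^k), c × c, c × c) > 0` — by
induction on `c` from `g((1), (1), (1)) = 1`, growing the square (`c ∉ S`) or growing and
transposing (`c ∈ S`). This replaces IP's "direct computation" of the base case `a = 7` of
Cor. 4.4 by a derivation from the one-row positivity alone.
[cite: IkenmeyerPanova2017, Cor. 4.4 (proof: "The values at a = 7 are readily verified by direct computation"; held: Cor. 21)] -/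
theorem hookSquare_pos_sum_odd {c : ℕ} (hc : 1 ≤ c) (S : Finset ℕ) (hS : S ⊆ Finset.Ico 1 c) :
    ∑ i ∈ S, (2 * i + 1) < c * c ∧
      ∀ lam : Nat.Partition (c * c),
        lam.parts = (c * c - ∑ i ∈ S, (2 * i + 1)) ::ₘ Multiset.replicate (∑ i ∈ S, (2 * i + 1)) 1 →
        0 < kroneckerCoeff ℂ lam (Nat.Partition.rectangle c c) (Nat.Partition.rectangle c c) := by
  induction c, hc using Nat.le_induction generalizing S with
  | base =>
    have hS0 : S = ∅ := Finset.subset_empty.1 (by simpa using hS)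
    subst hS0
    simpa using hookSquare_pos_one
  | succ c hc ih =>
    by_cases hcS : c ∈ S
    · have hS' : S.erase c ⊆ Finset.Ico 1 c := by
        intro i hi
        rw [Finset.mem_erase] at hi
        have h2 := Finset.mem_Ico.1 (hS hi.2)
        rw [Finset.mem_Ico]
        omega
      obtain ⟨hlt, hpos⟩ := ih (S.erase c) hS'
      have hsum : ∑ i ∈ S, (2 * i + 1) = ∑ i ∈ S.erase c, (2 * i + 1) + (2 * c + 1) :=
        (Finset.sum_erase_add S (fun i => 2 * i + 1) hcS).symm
      rw [hsum]
      refine ⟨by nlinarith, ?_⟩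
      exact hookSquare_pos_grow_add hlt hpos
    · have hS' : S ⊆ Finset.Ico 1 c := by
        intro i hi
        have h2 := Finset.mem_Ico.1 (hS hi)
        rw [Finset.mem_Ico]
        have : i ≠ c := fun h => hcS (h ▸ hi)
        omega
      obtain ⟨hlt, hpos⟩ := ih S hS'
      exact ⟨by nlinarith, hookSquare_pos_grow hlt hpos⟩

/-- The legs `j ∈ [0, 48]` outside `{1, 2, 4, 6, 42, 44, 46, 47}` are sums of distinct elements of
`{3, 5, 7, 9, 11, 13}` (a finite check). [folklore] -/
theorem exists_sum_odd_eq_of_lt_49 :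
    ∀ k < 49, k ∉ ({1, 2, 4, 6, 42, 44, 46, 47} : Finset ℕ) →
      ∃ S ∈ (Finset.Ico 1 7).powerset, ∑ i ∈ S, (2 * i + 1) = k := by
  decide

/-- **The base case `a = 7` of IP Cor. 4.4, derived rather than computed**: for every
`j ∈ [0, 48] ∖ {1, 2, 4, 6, 42, 44, 46, 47}`, `g((49 - j, 1^j), 7 × 7, 7 × 7) > 0`.
[cite: IkenmeyerPanova2017, Cor. 4.4 (proof, base case a = 7; held: Cor. 21)] -/
theorem hookSquare_pos_seven {k : ℕ} (hk : k < 49)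
    (hX : k ∉ ({1, 2, 4, 6, 42, 44, 46, 47} : Finset ℕ)) (lam : Nat.Partition (7 * 7))
    (hlam : lam.parts = (7 * 7 - k) ::ₘ Multiset.replicate k 1) :
    0 < kroneckerCoeff ℂ lam (Nat.Partition.rectangle 7 7) (Nat.Partition.rectangle 7 7) := by
  obtain ⟨S, hS, hsum⟩ := exists_sum_odd_eq_of_lt_49 k hk hX
  rw [Finset.mem_powerset] at hS
  obtain ⟨-, hpos⟩ := hookSquare_pos_sum_odd (c := 7) (by norm_num) S hS
  rw [hsum] at hpos
  exact hpos lam hlam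

/-- **IP Prop. 4.3 run for hooks** (`ρ = ∅`, `H¹ = {1, 2, 4, 6}`, `H² = {2, 3, 5, 7}`; held:
Prop. 20): for every `c ≥ 7` and `k ∈ [0, c² - 1] ∖ ({1, 2, 4, 6} ∪ (c² - {2, 3, 5, 7}))`,
`g((c² - k, 1^k), c × c, c × c) > 0` — induction on `c`: a leg `k ≤ c² - 8` of the larger square
is already good for the smaller one (grow), and a leg `k ≥ c² - 7` is `k' + 2c + 1` with `k'`
good for the smaller square (grow and transpose).
[cite: IkenmeyerPanova2017, Prop. 4.3 and Cor. 4.4 (held: Prop. 20, Cor. 21)] -/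
theorem hookSquare_pos {c : ℕ} (hc : 7 ≤ c) {k : ℕ} (hk : k < c * c) (h1 : k ≠ 1) (h2 : k ≠ 2)
    (h4 : k ≠ 4) (h6 : k ≠ 6) (h2' : k + 2 ≠ c * c) (h3' : k + 3 ≠ c * c) (h5' : k + 5 ≠ c * c)
    (h7' : k + 7 ≠ c * c) (lam : Nat.Partition (c * c))
    (hlam : lam.parts = (c * c - k) ::ₘ Multiset.replicate k 1) :
    0 < kroneckerCoeff ℂ lam (Nat.Partition.rectangle c c) (Nat.Partition.rectangle c c) := by
  induction c, hc using Nat.le_induction generalizing k with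
  | base =>
    refine hookSquare_pos_seven hk ?_ lam hlam
    simp only [Finset.mem_insert, Finset.mem_singleton]
    omega
  | succ c hc ih =>
    have hC : 2 * c + 15 ≤ c * c := by nlinarith
    have eC : (c + 1) * (c + 1) = c * c + 2 * c + 1 := by ring
    by_cases hsmall : k + 8 ≤ c * c
    · exact hookSquare_pos_grow (by omega)
        (fun mu hmu => ih (by omega) h1 h2 h4 h6 (by omega) (by omega) (by omega) (by omega) mu hmu)
        lam hlam
    · obtain ⟨k', rfl⟩ : ∃ k', k = k' + 2 * c + 1 := ⟨k - (2 * c + 1), by omega⟩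
      exact hookSquare_pos_grow_add (by omega)
        (fun mu hmu => ih (by omega) (by omega) (by omega) (by omega) (by omega) (by omega)
          (by omega) (by omega) (by omega) mu hmu)
        lam hlam

end Bootstrap

/-! ### IP Cor. 4.4 (held: Cor. 21) -/

section Cor44

/-- **Ikenmeyer–Panova, Adv. Math. 319 (2017), Cor. 4.4 (held arXiv text: Cor. 21), square
frame**: for `h ≥ 7` and `j ∈ [0, h² - 1] ∖ {1, 2, 4, 6, h² - 2, h² - 3, h² - 5, h² - 7}`,
`g((h² - j, 1^j), h × h, h × h) > 0` (the shape described by its parts). PROVED from the one-row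
positivity `g((n), μ, μ) = 1`, the semigroup property and the transposition property only — the
base case `h = 7`, "readily verified by direct computation" in print, is derived
(`hookSquare_pos_sum_odd`). [cite: IkenmeyerPanova2017, Cor. 4.4 (held: Cor. 21, p. 11)] -/
theorem ikenmeyerPanova2017_cor_4_4_square {h : ℕ} (h7 : 7 ≤ h) {j : ℕ} (hj : j < h ^ 2)
    (h1 : j ≠ 1) (h2 : j ≠ 2) (h4 : j ≠ 4) (h6 : j ≠ 6) (h2' : j + 2 ≠ h ^ 2)
    (h3' : j + 3 ≠ h ^ 2) (h5' : j + 5 ≠ h ^ 2) (h7' : j + 7 ≠ h ^ 2)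
    (lam : Nat.Partition (h * h)) (hlam : lam.parts = (h * h - j) ::ₘ Multiset.replicate j 1) :
    0 < kroneckerCoeff ℂ lam (Nat.Partition.rectangle h h) (Nat.Partition.rectangle h h) := by
  rw [sq] at hj h2' h3' h5' h7'
  exact hookSquare_pos h7 hj h1 h2 h4 h6 h2' h3' h5' h7' lam hlam

/-- **Ikenmeyer–Panova, Adv. Math. 319 (2017), Cor. 4.4 (held arXiv text: Cor. 21).** "Let
`w ≥ h ≥ 7`, then `g((hw - j, 1^j), h × w, h × w) > 0` for all
`j ∈ [0, h² - 1] ∖ {1, 2, 4, 6, h² - 2, h² - 3, h² - 5, h² - 7}`" (the hook `(hw - j, 1^j) ⊢ hw`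
described by its parts; the exclusions written additively). Printed proof: Prop. 4.3 with
`ρ = ∅`, `a = 7`, `H¹ = {1, 2, 4, 6}`, `H² = {2, 3, 5, 7}`, then "use the semigroup property once
to add the positive triple `((h(w-h)), h × (w-h), h × (w-h))`". PROVED, unconditionally: the
semigroup property (`ikenmeyerPanova2017_semigroup_holds`), the transposition property
(`ikenmeyerPanova2017_transposition_holds`) and `g((n), μ, μ) = 1`
(`kroneckerCoeff_indiscrete_pos`) are tree theorems, and the computed base case is derived
(`hookSquare_pos_seven`). [cite: IkenmeyerPanova2017, Cor. 4.4 (held: Cor. 21, p. 11)] -/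
theorem ikenmeyerPanova2017_cor_4_4 {h w : ℕ} (h7 : 7 ≤ h) (hhw : h ≤ w) {j : ℕ}
    (hj : j < h ^ 2) (h1 : j ≠ 1) (h2 : j ≠ 2) (h4 : j ≠ 4) (h6 : j ≠ 6) (h2' : j + 2 ≠ h ^ 2)
    (h3' : j + 3 ≠ h ^ 2) (h5' : j + 5 ≠ h ^ 2) (h7' : j + 7 ≠ h ^ 2)
    (lam : Nat.Partition (h * w)) (hlam : lam.parts = (h * w - j) ::ₘ Multiset.replicate j 1) :
    0 < kroneckerCoeff ℂ lam (Nat.Partition.rectangle h w) (Nat.Partition.rectangle h w) := by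
  have hjh : j < h * h := by rw [sq] at hj; exact hj
  obtain ⟨lam₀, hlam₀⟩ := exists_parts_eq_hook (N := h * h) hjh
  have h₀ := ikenmeyerPanova2017_cor_4_4_square h7 hj h1 h2 h4 h6 h2' h3' h5' h7' lam₀ hlam₀
  have e : h * h + h * (w - h) = h * w := by
    rw [← Nat.mul_add, Nat.add_sub_cancel' hhw]
  let mu : Nat.Partition (h * (h + (w - h))) :=
    ⟨lam.parts, lam.parts_pos, by rw [lam.parts_sum, Nat.add_sub_cancel' hhw]⟩
  have hmu : mu.parts = (lam₀.rowAdd (Nat.Partition.indiscrete (h * (w - h)))).parts := by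
    change lam.parts = _
    rw [hlam, parts_rowAdd_indiscrete_of_parts_eq_hook hjh hlam₀, e]
  have h₁ := kroneckerCoeff_pos_rowAdd_row_holds lam₀ h₀ mu hmu
  rwa [kroneckerCoeff_congr_parts (lam := mu) (lam' := lam) (mu' := Nat.Partition.rectangle h w)
    (nu' := Nat.Partition.rectangle h w) (by rw [Nat.add_sub_cancel' hhw]) rfl
    (by rw [Nat.add_sub_cancel' hhw]) (by rw [Nat.add_sub_cancel' hhw])] at h₁

/-- A partition with body `λ̄ = (1^j)` (IP's `body`) of `N > 0` is the hook `(N - j, 1^j)`: its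
parts are `{N - j, 1, …, 1}`. [cite: IkenmeyerPanova2017, §1.1 (the body `λ̄`) and §4 (hooks)] -/
theorem parts_eq_hook_of_body_eq_replicate {N : ℕ} (hN : 0 < N) (lam : Nat.Partition N) {j : ℕ}
    (hbody : body lam = Multiset.replicate j 1) :
    lam.parts = (N - j) ::ₘ Multiset.replicate j 1 := by
  have hne : lam.parts ≠ 0 := by
    intro h0
    have := lam.parts_sum
    rw [h0, Multiset.sum_zero] at this
    omega
  have hsplit := Multiset.cons_erase (sup_mem_of_ne_zero hne)
  have hsum : lam.parts.sup + j = N := by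
    have h := lam.parts_sum
    rw [← hsplit, Multiset.sum_cons] at h
    change lam.parts.sup + (body lam).sum = N at h
    rwa [hbody, Multiset.sum_replicate, smul_eq_mul, mul_one] at h
  rw [← hsplit]
  change lam.parts.sup ::ₘ body lam = _
  rw [hbody, show lam.parts.sup = N - j by omega]

/-- **IP Cor. 4.4 in the vocabulary of the statement file** (`body`, as in
`ikenmeyerPanova2017_thm_4_6`): for `w ≥ h ≥ 7` and `λ ⊢ hw` with body `λ̄ = (1^j)`,
`j ∈ [0, h² - 1] ∖ {1, 2, 4, 6, h² - 2, h² - 3, h² - 5, h² - 7}`, `g(λ, h × w, h × w) > 0`.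
[cite: IkenmeyerPanova2017, Cor. 4.4 (held: Cor. 21, p. 11)] -/
theorem ikenmeyerPanova2017_cor_4_4_body {h w : ℕ} (h7 : 7 ≤ h) (hhw : h ≤ w)
    (lam : Nat.Partition (h * w)) {j : ℕ} (hbody : body lam = Multiset.replicate j 1)
    (hj : j < h ^ 2) (h1 : j ≠ 1) (h2 : j ≠ 2) (h4 : j ≠ 4) (h6 : j ≠ 6) (h2' : j + 2 ≠ h ^ 2)
    (h3' : j + 3 ≠ h ^ 2) (h5' : j + 5 ≠ h ^ 2) (h7' : j + 7 ≠ h ^ 2) :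
    0 < kroneckerCoeff ℂ lam (Nat.Partition.rectangle h w) (Nat.Partition.rectangle h w) :=
  ikenmeyerPanova2017_cor_4_4 h7 hhw hj h1 h2 h4 h6 h2' h3' h5' h7' lam
    (parts_eq_hook_of_body_eq_replicate (Nat.mul_pos (by omega) (by omega)) lam hbody)

end Cor44


/-! ### Square positivity for squares of square side, from the one-row positivity alone -/

section Squares

/-- The rows of the `a × b` rectangle: `b` on the first `a` rows (nothing if `b = 0`).
[folklore] -/
theorem getD_sortedParts_rectangle (a b r : ℕ) :
    (Nat.Partition.rectangle a b).sortedParts.getD r 0 = if r < a then b else 0 := by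
  rcases Nat.eq_zero_or_pos b with rfl | hb
  · have h0 : (Nat.Partition.rectangle a 0).sortedParts = [] := by
      rw [← List.length_eq_zero_iff, Nat.Partition.length_sortedParts]
      simp [Nat.Partition.rectangle, Nat.Partition.ofSums]
    simp [h0]
  · rw [sortedParts_rectangle a b hb.ne', List.getD_eq_getElem?_getD, List.getElem?_replicate]
    split_ifs <;> rfl

/-- A partition with the parts of the tall rectangle `(s²) × t` but written size `s·(s·t)`
exists. [folklore] -/
theorem exists_parts_eq_tallRectangle (s t : ℕ) :
    ∃ nu : Nat.Partition (s * (s * t)), nu.parts = (Nat.Partition.rectangle (s * s) t).parts :=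
  ⟨⟨(Nat.Partition.rectangle (s * s) t).parts, (Nat.Partition.rectangle (s * s) t).parts_pos,
    by rw [(Nat.Partition.rectangle (s * s) t).parts_sum, mul_assoc]⟩, rfl⟩

/-- **`g(s × (st), s × (st), (s²) × t) > 0`**: `t` copies of the triple
`(s × s, s × s, (1^{s²}))` — positive because the square is self-conjugate,
`g((1^{n}), ρ, ρᵀ) = g((n), ρᵀ, ρᵀ) = 1` — added with the semigroup property (the third shape
described by its parts). [folklore] -/
theorem kroneckerCoeff_rect_rect_tallRect_pos (s t : ℕ) (nu : Nat.Partition (s * (s * t)))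
    (hnu : nu.parts = (Nat.Partition.rectangle (s * s) t).parts) :
    0 < kroneckerCoeff ℂ (Nat.Partition.rectangle s (s * t)) (Nat.Partition.rectangle s (s * t))
      nu := by
  induction t with
  | zero => exact kroneckerCoeff_pos_of_eq_zero (by simp) _ _ _
  | succ t ih =>
    -- the basic triple `(s × s, s × s, (1^{s²}))`
    have hcol : 0 < kroneckerCoeff ℂ (Nat.Partition.rectangle s s) (Nat.Partition.rectangle s s)
        (Nat.Partition.indiscrete (s * s)).transpose := by
      have h := kroneckerCoeff_indiscrete_transpose_pos ℂ (Nat.Partition.rectangle s s)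
      rw [kroneckerCoeff_congr_parts rfl (lam := (Nat.Partition.indiscrete (s * s)).transpose)
        (lam' := (Nat.Partition.indiscrete (s * s)).transpose) (mu' := Nat.Partition.rectangle s s)
        (nu' := Nat.Partition.rectangle s s) rfl rfl (transpose_rectangle_parts s s),
        Literature.NumberTheory.DiophantineGeometry.kroneckerCoeff_comm₁₂_holds ℂ,
        Literature.NumberTheory.DiophantineGeometry.kroneckerCoeff_comm₂₃_holds ℂ] at h
      exact h
    obtain ⟨nu₀, hnu₀⟩ := exists_parts_eq_tallRectangle s t
    have h := ikenmeyerPanova2017_semigroup_holds _ _ _ _ _ _ (ih nu₀ hnu₀) hcol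
    have hp := rowAdd_rectangle_parts s (s * t) s
    have e : s * t + s = s * (t + 1) := by ring
    have hR : ((Nat.Partition.rectangle s (s * t)).rowAdd (Nat.Partition.rectangle s s)).parts =
        (Nat.Partition.rectangle s (s * (t + 1))).parts := by rw [hp, e]
    have hN : (nu₀.rowAdd (Nat.Partition.indiscrete (s * s)).transpose).parts = nu.parts := by
      rw [hnu]
      refine parts_eq_of_getD_sortedParts_eq fun r => ?_
      rw [getD_sortedParts_rowAdd, sortedParts_congr_parts hnu₀, getD_sortedParts_rectangle,
        Literature.NumberTheory.DiophantineGeometry.getD_sortedParts_indiscrete_transpose,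
        getD_sortedParts_rectangle]
      split_ifs <;> rfl
    rwa [kroneckerCoeff_congr_parts (by ring : s * (s * t) + s * s = s * (s * (t + 1)))
      (lam' := Nat.Partition.rectangle s (s * (t + 1)))
      (mu' := Nat.Partition.rectangle s (s * (t + 1))) (nu' := nu) hR hR hN] at h

/-- **The cube of the tall rectangle `(s²) × s` is positive**:
`g((s²) × s, (s²) × s, (s²) × s) > 0` — transpose the two wide rectangles `s × s²` of
`kroneckerCoeff_rect_rect_tallRect_pos` (`t = s`). [folklore] -/
theorem kroneckerCoeff_tallRect_cube_pos (s : ℕ) :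
    0 < kroneckerCoeff ℂ (Nat.Partition.rectangle (s * s) s) (Nat.Partition.rectangle (s * s) s)
      (Nat.Partition.rectangle (s * s) s) := by
  obtain ⟨nu, hnu⟩ := exists_parts_eq_tallRectangle s s
  have h := kroneckerCoeff_rect_rect_tallRect_pos s s nu hnu
  rw [kroneckerCoeff_transpose₁₂] at h
  rwa [kroneckerCoeff_congr_parts (mul_assoc s s s).symm
    (lam' := Nat.Partition.rectangle (s * s) s) (mu' := Nat.Partition.rectangle (s * s) s)
    (nu' := Nat.Partition.rectangle (s * s) s) (transpose_rectangle_parts s (s * s))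
    (transpose_rectangle_parts s (s * s)) hnu] at h

/-- **`g((s²) × (su), (s²) × (su), (s²) × (su)) > 0`** for all `s, u`: `u` tall cubes side by
side (semigroup property). [folklore] -/
theorem kroneckerCoeff_rectangle_sq_mul_cube_pos (s u : ℕ) :
    0 < kroneckerCoeff ℂ (Nat.Partition.rectangle (s * s) (s * u))
      (Nat.Partition.rectangle (s * s) (s * u)) (Nat.Partition.rectangle (s * s) (s * u)) := by
  induction u with
  | zero => exact kroneckerCoeff_pos_of_eq_zero (by simp) _ _ _
  | succ u ih =>
    have h := ikenmeyerPanova2017_semigroup_holds _ _ _ _ _ _ ih (kroneckerCoeff_tallRect_cube_pos s)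
    have hp := rowAdd_rectangle_parts (s * s) (s * u) s
    have e : s * u + s = s * (u + 1) := by ring
    have hR : ((Nat.Partition.rectangle (s * s) (s * u)).rowAdd
        (Nat.Partition.rectangle (s * s) s)).parts =
        (Nat.Partition.rectangle (s * s) (s * (u + 1))).parts := by rw [hp, e]
    rwa [kroneckerCoeff_congr_parts (by ring : s * s * (s * u) + s * s * s = s * s * (s * (u + 1)))
      (lam' := Nat.Partition.rectangle (s * s) (s * (u + 1)))
      (mu' := Nat.Partition.rectangle (s * s) (s * (u + 1)))
      (nu' := Nat.Partition.rectangle (s * s) (s * (u + 1))) hR hR hR] at h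

/-- **The square positivity for squares of square side, unconditionally**:
`g(k × k, k × k, k × k) > 0` for every perfect square `k = s²` — the case `k = s²` of the
Bessenrodt–Behns square positivity quoted in IP §1.1 (the named fact
`ikenmeyerPanova2017_square_pos`), here derived from `g((n), μ, μ) = 1`, the semigroup property
and the transposition property alone. (For `k` not a perfect square the cube `(k × k)³` is NOT a
row-wise sum of positive triples — every row-wise decomposition of `(k × k, k × k, k × k)` is into
cubes `(k × kᵢ)³` — so no such derivation exists for it; see the module docstring.)
[cite: IkenmeyerPanova2017, §1.1 (the square positivity; held p. 5), case k = s²] -/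
theorem ikenmeyerPanova2017_square_pos_of_sq (s : ℕ) :
    0 < kroneckerCoeff ℂ (Nat.Partition.rectangle (s * s) (s * s))
      (Nat.Partition.rectangle (s * s) (s * s)) (Nat.Partition.rectangle (s * s) (s * s)) :=
  kroneckerCoeff_rectangle_sq_mul_cube_pos s s

end Squares


/-! ### Unions of good columns: summand (IV) of the proof of IP Thm. 4.6 -/

section ColumnUnions

/-- Two partitions of the same number with the same rows below the first have the same parts (the
first row is determined by the size). [folklore] -/
theorem parts_eq_of_getD_succ_eq {N N' : ℕ} (hN : N = N') (μ : Nat.Partition N)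
    (ν : Nat.Partition N') (h : ∀ r, μ.sortedParts.getD (r + 1) 0 = ν.sortedParts.getD (r + 1) 0) :
    μ.parts = ν.parts := by
  subst hN
  refine parts_eq_of_getD_sortedParts_eq fun r => ?_
  cases r with
  | succ r => exact h r
  | zero =>
    set L := max μ.parts.card ν.parts.card with hL
    have hμ := sum_range_getD_sortedParts_of_le μ (L := L + 1) (by omega)
    have hν := sum_range_getD_sortedParts_of_le ν (L := L + 1) (by omega)
    rw [Finset.sum_range_succ'] at hμ hν
    have ht : ∑ i ∈ Finset.range L, μ.sortedParts.getD (i + 1) 0 =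
        ∑ i ∈ Finset.range L, ν.sortedParts.getD (i + 1) 0 := Finset.sum_congr rfl fun i _ => h i
    omega

/-- **Growing the frame in both directions**: if `g(μ, c × d, c × d) > 0`, `c ≤ a`, `d ≤ b`, and
`λ ⊢ ab` has the same rows as `μ` below the first, then `g(λ, a × b, a × b) > 0` (add the one-row
triples `((c(b-d))), c × (b-d), c × (b-d))` and, after transposing the rectangles,
`(((a-c)b), …)`: IP's two constant moves). [cite: IkenmeyerPanova2017, Prop. 4.3 and Cor. 4.4 (proofs; held: Prop. 20, Cor. 21)] -/
theorem kroneckerCoeff_pos_of_frame_le {c d a b : ℕ} (mu : Nat.Partition (c * d))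
    (hmu : 0 < kroneckerCoeff ℂ mu (Nat.Partition.rectangle c d) (Nat.Partition.rectangle c d))
    (hca : c ≤ a) (hdb : d ≤ b) (lam : Nat.Partition (a * b))
    (hrows : ∀ r, lam.sortedParts.getD (r + 1) 0 = mu.sortedParts.getD (r + 1) 0) :
    0 < kroneckerCoeff ℂ lam (Nat.Partition.rectangle a b) (Nat.Partition.rectangle a b) := by
  -- grow the width `d ↦ b`
  let mu₁ : Nat.Partition (c * (d + (b - d))) :=
    ⟨(mu.rowAdd (Nat.Partition.indiscrete (c * (b - d)))).parts,
      (mu.rowAdd (Nat.Partition.indiscrete (c * (b - d)))).parts_pos, by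
      rw [(mu.rowAdd (Nat.Partition.indiscrete (c * (b - d)))).parts_sum, Nat.mul_add]⟩
  have h₁ := kroneckerCoeff_pos_rowAdd_row_holds mu hmu mu₁ rfl
  -- grow the rows `c ↦ a`
  let mu₂ : Nat.Partition ((c + (a - c)) * (d + (b - d))) :=
    ⟨(mu₁.rowAdd (Nat.Partition.indiscrete ((a - c) * (d + (b - d))))).parts,
      (mu₁.rowAdd (Nat.Partition.indiscrete ((a - c) * (d + (b - d))))).parts_pos, by
      rw [(mu₁.rowAdd (Nat.Partition.indiscrete ((a - c) * (d + (b - d))))).parts_sum,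
        Nat.add_mul]⟩
  have h₂ := kroneckerCoeff_pos_rowAdd_row_rows mu₁ h₁ mu₂ rfl
  -- compare with `λ` through the rows below the first
  have hsize : (c + (a - c)) * (d + (b - d)) = a * b := by
    rw [Nat.add_sub_cancel' hca, Nat.add_sub_cancel' hdb]
  have hparts : mu₂.parts = lam.parts := by
    refine parts_eq_of_getD_succ_eq hsize mu₂ lam fun r => ?_
    rw [hrows r]
    change (mu₁.rowAdd _).sortedParts.getD (r + 1) 0 = _
    rw [getD_sortedParts_rowAdd_indiscrete, if_neg (Nat.succ_ne_zero r), add_zero]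
    change (mu.rowAdd _).sortedParts.getD (r + 1) 0 = _
    rw [getD_sortedParts_rowAdd_indiscrete, if_neg (Nat.succ_ne_zero r), add_zero]
  rwa [kroneckerCoeff_congr_parts hsize (lam' := lam) (mu' := Nat.Partition.rectangle a b)
    (nu' := Nat.Partition.rectangle a b) hparts
    (by rw [Nat.add_sub_cancel' hca, Nat.add_sub_cancel' hdb])
    (by rw [Nat.add_sub_cancel' hca, Nat.add_sub_cancel' hdb])] at h₂

/-- **Growing the transposed frame**: if `g(μ, c × d, c × d) > 0`, `d ≤ a`, `c ≤ b`, and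
`λ ⊢ ab` has the same rows as `μ` below the first, then `g(λ, a × b, a × b) > 0` (transpose the
rectangles first). [cite: IkenmeyerPanova2017, Prop. 4.3 and Cor. 4.4 (proofs; held: Prop. 20, Cor. 21)] -/
theorem kroneckerCoeff_pos_of_frame_le' {c d a b : ℕ} (mu : Nat.Partition (c * d))
    (hmu : 0 < kroneckerCoeff ℂ mu (Nat.Partition.rectangle c d) (Nat.Partition.rectangle c d))
    (hda : d ≤ a) (hcb : c ≤ b) (lam : Nat.Partition (a * b))
    (hrows : ∀ r, lam.sortedParts.getD (r + 1) 0 = mu.sortedParts.getD (r + 1) 0) :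
    0 < kroneckerCoeff ℂ lam (Nat.Partition.rectangle a b) (Nat.Partition.rectangle a b) := by
  let mu' : Nat.Partition (d * c) := ⟨mu.parts, mu.parts_pos, by rw [mu.parts_sum, mul_comm]⟩
  have hmu' : 0 < kroneckerCoeff ℂ mu' (Nat.Partition.rectangle d c)
      (Nat.Partition.rectangle d c) := by
    rwa [kroneckerCoeff_rectangle_transpose mu mu' rfl] at hmu
  have hsp : mu'.sortedParts = mu.sortedParts := sortedParts_congr_parts rfl
  exact kroneckerCoeff_pos_of_frame_le mu' hmu' hda hcb lam fun r => by rw [hrows r, hsp]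

/-- The rows of a union of columns: prepending a column of length `j` to the multiset `J` of
column lengths adds `1` to the rows `1, …, j`. [folklore] -/
theorem card_filter_le_cons (j : ℕ) (J : Multiset ℕ) (r : ℕ) :
    ((j ::ₘ J).filter (r ≤ ·)).card = (if r ≤ j then 1 else 0) + (J.filter (r ≤ ·)).card := by
  rw [Multiset.filter_cons, Multiset.card_add]
  split_ifs <;> simp

/-- **A union of good columns is positive against `h × (hm)`** (`m` = the number of columns):
for `h ≥ 7` and a multiset `J` of column lengths, each in
`[0, h² - 1] ∖ {1, 2, 4, 6, h² - 2, h² - 3, h² - 5, h² - 7}`, there is a partition of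
`h · (h · |J|)` whose body is the union of the columns `J` (rows `r ≥ 1`:
`#{j ∈ J : j ≥ r}`), and it satisfies `g(λ, h × h|J|, h × h|J|) > 0` — the hooks of Cor. 4.4
added with the semigroup property (IP, proof of Thm. 4.6, summand (IV): "we can use Corollary
4.4 to obtain `g((k̄ × 1)(w²), w × w, w × w) > 0` … the semigroup property gives
`g(ξ(w²ℓ̄), w × (wℓ̄), w × (wℓ̄)) > 0`"; here the columns need not be distinct).
[cite: IkenmeyerPanova2017, Thm. 4.6 (proof, eq. (IV); held: Thm. 23, p. 12)] -/
theorem exists_colUnion_pos {h : ℕ} (h7 : 7 ≤ h) (J : Multiset ℕ)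
    (hJ : ∀ j ∈ J, j < h ^ 2 ∧ j ≠ 1 ∧ j ≠ 2 ∧ j ≠ 4 ∧ j ≠ 6 ∧ j + 2 ≠ h ^ 2 ∧ j + 3 ≠ h ^ 2 ∧
      j + 5 ≠ h ^ 2 ∧ j + 7 ≠ h ^ 2) :
    ∃ mu : Nat.Partition (h * (h * Multiset.card J)),
      (∀ r, mu.sortedParts.getD (r + 1) 0 = (J.filter (r + 1 ≤ ·)).card) ∧
      0 < kroneckerCoeff ℂ mu (Nat.Partition.rectangle h (h * Multiset.card J))
        (Nat.Partition.rectangle h (h * Multiset.card J)) := by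
  induction J using Multiset.induction_on with
  | empty =>
    refine ⟨⟨0, fun h => by simp at h, by simp⟩, fun r => ?_,
      kroneckerCoeff_pos_of_eq_zero (by simp) _ _ _⟩
    simp [Nat.Partition.sortedParts]
  | cons j J ih =>
    obtain ⟨mu', hrows', hpos'⟩ := ih fun j' hj' => hJ j' (Multiset.mem_cons_of_mem hj')
    obtain ⟨hj, h1, h2, h4, h6, h2', h3', h5', h7'⟩ := hJ j (Multiset.mem_cons_self j J)
    have hjh : j < h * h := by rw [sq] at hj; exact hj
    obtain ⟨nu, hnu⟩ := exists_parts_eq_hook (N := h * h) hjh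
    have hnupos := ikenmeyerPanova2017_cor_4_4_square h7 hj h1 h2 h4 h6 h2' h3' h5' h7' nu hnu
    have hsg := ikenmeyerPanova2017_semigroup_holds _ _ _ _ _ _ hnupos hpos'
    have e : h * h + h * (h * Multiset.card J) = h * (h * Multiset.card (j ::ₘ J)) := by
      rw [Multiset.card_cons]; ring
    let mu : Nat.Partition (h * (h * Multiset.card (j ::ₘ J))) :=
      ⟨(nu.rowAdd mu').parts, (nu.rowAdd mu').parts_pos, by rw [(nu.rowAdd mu').parts_sum, e]⟩
    have hR : ((Nat.Partition.rectangle h h).rowAdd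
        (Nat.Partition.rectangle h (h * Multiset.card J))).parts =
        (Nat.Partition.rectangle h (h * Multiset.card (j ::ₘ J))).parts := by
      rw [rowAdd_rectangle_parts, Multiset.card_cons,
        show h + h * Multiset.card J = h * (Multiset.card J + 1) by ring]
    refine ⟨mu, fun r => ?_, ?_⟩
    · change (nu.rowAdd mu').sortedParts.getD (r + 1) 0 = _
      rw [getD_sortedParts_rowAdd, getD_sortedParts_of_parts_eq_hook hjh hnu, hrows' r,
        card_filter_le_cons, if_neg (Nat.succ_ne_zero r)]
    · rwa [kroneckerCoeff_congr_parts e (lam' := mu)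
        (mu' := Nat.Partition.rectangle h (h * Multiset.card (j ::ₘ J)))
        (nu' := Nat.Partition.rectangle h (h * Multiset.card (j ::ₘ J))) rfl hR hR] at hsg

/-- **Summand (IV) of the proof of IP Thm. 4.6, in every frame**: let `h ≥ 7` and let `λ ⊢ ab` be a
partition whose body `λ̄` is a union of columns of lengths `J` (rows `λ_{r+1} = #{j ∈ J : j ≥ r+1}`,
multiplicities allowed), each length in `[0, h² - 1] ∖ {1, 2, 4, 6, h² - 2, h² - 3, h² - 5, h² - 7}`.
If `a ≥ h` and `b ≥ h·|J|`, then `g(λ, a × b, a × b) > 0`. (IP: `ξ` = the columns of `ν` of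
pairwise distinct lengths not in `{1, 2, 4, 6}`, `h = w = max(⌈√(ℓ(ν)+8)⌉, 7)`, frame
`a × w` with `a ≥ w(ℓ-1)` after transposing — the primed version below.) Unconditional: Cor. 4.4
(`ikenmeyerPanova2017_cor_4_4_square`) and the semigroup property.
[cite: IkenmeyerPanova2017, Thm. 4.6 (proof, eq. (IV); held: Thm. 23, p. 12)] -/
theorem ikenmeyerPanova2017_thm_4_6_summand_IV {h a b : ℕ} (h7 : 7 ≤ h) (J : Multiset ℕ)
    (hJ : ∀ j ∈ J, j < h ^ 2 ∧ j ≠ 1 ∧ j ≠ 2 ∧ j ≠ 4 ∧ j ≠ 6 ∧ j + 2 ≠ h ^ 2 ∧ j + 3 ≠ h ^ 2 ∧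
      j + 5 ≠ h ^ 2 ∧ j + 7 ≠ h ^ 2)
    (ha : h ≤ a) (hb : h * Multiset.card J ≤ b) (lam : Nat.Partition (a * b))
    (hrows : ∀ r, lam.sortedParts.getD (r + 1) 0 = (J.filter (r + 1 ≤ ·)).card) :
    0 < kroneckerCoeff ℂ lam (Nat.Partition.rectangle a b) (Nat.Partition.rectangle a b) := by
  obtain ⟨mu, hmu, hpos⟩ := exists_colUnion_pos h7 J hJ
  exact kroneckerCoeff_pos_of_frame_le mu hpos ha hb lam fun r => by rw [hrows r, hmu r]

/-- **Summand (IV) of the proof of IP Thm. 4.6, transposed frame** (the form used in print: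
`g(ξ(aw), a × w, a × w) > 0` for `a ≥ w·#columns`): as `ikenmeyerPanova2017_thm_4_6_summand_IV`
with `a ≥ h·|J|` and `b ≥ h`. [cite: IkenmeyerPanova2017, Thm. 4.6 (proof, eq. (IV); held: Thm. 23, p. 12)] -/
theorem ikenmeyerPanova2017_thm_4_6_summand_IV' {h a b : ℕ} (h7 : 7 ≤ h) (J : Multiset ℕ)
    (hJ : ∀ j ∈ J, j < h ^ 2 ∧ j ≠ 1 ∧ j ≠ 2 ∧ j ≠ 4 ∧ j ≠ 6 ∧ j + 2 ≠ h ^ 2 ∧ j + 3 ≠ h ^ 2 ∧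
      j + 5 ≠ h ^ 2 ∧ j + 7 ≠ h ^ 2)
    (ha : h * Multiset.card J ≤ a) (hb : h ≤ b) (lam : Nat.Partition (a * b))
    (hrows : ∀ r, lam.sortedParts.getD (r + 1) 0 = (J.filter (r + 1 ≤ ·)).card) :
    0 < kroneckerCoeff ℂ lam (Nat.Partition.rectangle a b) (Nat.Partition.rectangle a b) := by
  obtain ⟨mu, hmu, hpos⟩ := exists_colUnion_pos h7 J hJ
  exact kroneckerCoeff_pos_of_frame_le' mu hpos ha hb lam fun r => by rw [hrows r, hmu r]

end ColumnUnions

end Literature.Computability.Complexity
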